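/-
Copyright (c) 2026 the pub-hodgecm-mathlib formalisation cell (harness21).  Prover seat hodgecm-mathlib-LH4-p08 (g4), Track A «(D-RAM) FOUR-FRAME», unit U2H, the census leaf
(ρ2b′-X) `stub_U2H_fixedPointCensus_typeTwo_unit0` — dealer LH4-plan (g12) WORD #16∕#21 hand T5a «TORIC LEVEL CENSUS, K-UNRAMIFIED» (payer LH4-p14 (g3); plan owner LH4-p12 (g4)
T5-FRAME v1 F2∕F4): the three INDEX VALUES of the type-U census, read in `Mˣ`.  2026-09-04.
-/
import Literature.NumberTheory.LocalFields.WildQuadraticDatumUnitDepthIndex   -- ★ p857227 (this seat): Mars' index in valued-datum currency; brings ★ Mars, ★ Flicker `UnramifiedQuadraticOrderUnitIndex`, ★ `mem_maximalIdeal_pow_iff_v_le`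
import HarnessLib

/-!
# The three indices of the K-unramified toric census, as relative indices of binder-characterised subgroups of `Mˣ`:
# `[U_M : 𝒪_jˣ] = (q+1)q^{j−1}` (Flicker), `[Ũ : Ṽ_{d+2m}] = q^m` (Mars on the third field, along `jK : K♮ →+* M`), `[U_M : B_r] = [Ũ : Ṽ_r]` (norm pull-back)
(Flicker 1998 Prop. 7 p. 84 ∕ §6 REMARK (Mars); Serre, *Local Fields* Ch. V §1–§3)

Topic `NumberTheory/LocalFields`; namespace `Literature.NumberTheory.LocalFields.QuadraticOrder`.  THEOREMS ONLY (no definition, no instance, no notation, no named fact, no `sorry`); kernel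
lane `--supports stmt-HodgeConjecture-24833` (count-neutral).  Cell `pub/hodgecm-mathlib` (D-0151), crux H413, Track A «(D-RAM) FOUR-FRAME», unit U2H: the hyperbolic-side counts of the
type-U toric census (this seat's T5a sheet v3 (UNR+), mechanism (M4)–(M7)) are `[B_{j−a} : 𝒪_jˣ] − [B_{j−a+1} : 𝒪_jˣ]` with `B_r = {ω : |ω| = 1, |ωΘω − ρ(ωΘω)| ≤ r}` (★-GREEN
`QuadraticOrderNormTwistClasses`, the translation lemma), and `[B_r : 𝒪_jˣ] = [U_M : 𝒪_jˣ] ∕ [U_M : B_r]`.  THIS FILE reads the three indices in `Mˣ`, all subgroups characterised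
by MEMBERSHIP binders (def-free, ★ `RamifiedPlaceOrderUnitIndex` style):
* §1 **`relIndex_orderUnits_eq_of_unramified`** — `[U_M : {|u| = 1, |u − ρu| ≤ |ϖ^j|}] = (q+1)q^{j−1}` (`j ≥ 1`; `M ∕ E` UNRAMIFIED: an integer `α` with `|α − ρα| = 1`;
  `#𝓀[M] = q²`): ★ Flicker `UnramifiedQuadraticOrderUnitIndex.index_comap_eqLocus_eq` at `R = 𝒪[M]` transported along `𝒪[M]ˣ ↪ Mˣ` (★ p857227 §1∕§3 plumbing).
* §2 **`relIndex_thetaFixed_depth_eq_pow`** — `[Ũ : Ṽ_{d+2m}] = q^m` (+ ED. 2: odd levels `q^{m+1}`, levels `≤ d` ↦ `1`, stated for an ORDER-COMPATIBLE embedding `hjle` so the ramified `M ∕ K♮` of T5c reuses them; the even-level order-compatible variant is LH4-p06 (g4)'s ★ `QuadraticOrderTorusIndicesRamified.relIndex_thetaFixed_depth_eq_pow_of_le_iff`) for `Ũ = {Θz = z, |z| = 1}`, `Ṽ_k = Ũ ∩ {|z − ρz| ≤ |π^k|}`, when the THIRD FIELD is handed over as a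
  valued field `K′` with a ramified quadratic datum `(σ′, π′, d)` and an isometric embedding `jK : K′ →+* M` onto `Fix Θ` intertwining `σ′` with `ρ` (★ p857227
  `relIndex_eq_pow_of_depth` transported along the injective `Units.map jK`).
* §3 **`relIndex_normDepth_eq`** — `[U_M : B_r] = [Ũ : Ṽ_r]` when the norm `ω ↦ ωΘω` maps `U_M` ONTO `Ũ` (binder `hnorm`; Serre V §2 for `M ∕ K♮` unramified): `B_r = U_M ⊓ N⁻¹(Ṽ_r)`,
  `Subgroup.relIndex_comap`.  (The quotient `[B_r : 𝒪_jˣ]·[U_M : B_r] = [U_M : 𝒪_jˣ]` is Mathlib's `Subgroup.relIndex_mul_relIndex`.)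
HONEST LABEL: HC_CM is proved only modulo the 7 printed citations (2 remaining named inputs: hLiu418 = stmt-HodgeConjecture-24832, h413 = stmt-HodgeConjecture-24833) until rung 0
closes; unconditional algebra, count-neutral (organ F2∕F4-U of the (ρ2b′-X) payer plan; no census value asserted).

## References
* [Flicker1998UnitaryFL] Y. Z. Flicker, *Elementary proof of the fundamental lemma for a unitary group*, Canad. J. Math. 50 (1998): Prop. 7 p. 84; §6 p. 95 REMARK (Mars).
* [Serre1979] J.-P. Serre, *Local Fields*, GTM 67 (1979): Ch. V §1 (units, filtration), §2 Prop. 3 (unit norms in unramified extensions), §3 (ramified quadratic norm-one groups).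
-/

set_option autoImplicit false

open WithZero IsLocalRing
open scoped Valued

namespace Literature.NumberTheory.LocalFields.QuadraticOrder

open Literature.NumberTheory.LocalFields.WildQuadraticDatum Literature.NumberTheory.LocalFields.UnramifiedQuadraticNorm

/-! ## §1 Flicker's index `[U_M : 𝒪_jˣ] = (q+1)q^{j−1}` in `Mˣ` (M∕E unramified) -/

section Flicker

variable {K : Type*} [Field K] [Valued K ℤᵐ⁰] {ρ : K →+* K} {α ϖ : K}

/-- **FLICKER'S ORDER-UNIT INDEX IN `Mˣ`** (`M ∕ E` unramified frame: an integer `α` moved by `ρ` by a UNIT; `#𝓀[M] = q²`): for `j ≥ 1` and subgroups `U, H ≤ Mˣ` with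
`u ∈ U ↔ |u| = 1`, `u ∈ H ↔ |u| = 1 ∧ |u − ρu| ≤ |ϖ^j|`, **`H.relIndex U = (q + 1)·q^{j−1}`** (★ `index_comap_eqLocus_eq` at `R = 𝒪[M]`). [cite: Flicker1998UnitaryFL, Prop. 7 p. 84]
[cite: Serre1979, Ch. V §2 Prop. 3] -/
theorem relIndex_orderUnits_eq_of_unramified (hρρ : ∀ x, ρ (ρ x) = x) (hvρ : ∀ x, Valued.v (ρ x) = Valued.v x) (hα1 : Valued.v α ≤ 1) (hα : Valued.v (α - ρ α) = 1)
    (hϖ : Valued.v ϖ = exp (-1 : ℤ)) [IsDiscreteValuationRing 𝒪[K]] [Finite 𝓀[K]] {q : ℕ} (hq : Nat.card 𝓀[K] = q ^ 2) {j : ℕ} (hj : 1 ≤ j)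
    (U H : Subgroup Kˣ) (hU : ∀ u, u ∈ U ↔ Valued.v (u : K) = 1)
    (hH : ∀ u, u ∈ H ↔ Valued.v (u : K) = 1 ∧ Valued.v ((u : K) - ρ u) ≤ Valued.v (ϖ ^ j)) :
    H.relIndex U = (q + 1) * q ^ (j - 1) := by
  obtain ⟨σO, hσO⟩ := exists_ringHom_integer hvρ
  have hσOO := ringHom_integer_involutive hρρ hσO
  set f : (𝒪[K])ˣ →* Kˣ := Units.map (𝒪[K]).subtype.toMonoidHom with hf
  set Mj : Subgroup (𝒪[K])ˣ :=
    ((Units.map (Ideal.quotientMap (maximalIdeal 𝒪[K] ^ j) σO (maximalIdeal_pow_le_comap σO hσOO j)).toMonoidHom).eqLocus (MonoidHom.id _)).comap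
      (Units.map (Ideal.Quotient.mk (maximalIdeal 𝒪[K] ^ j)).toMonoidHom) with hMj
  obtain ⟨hrange, hinj⟩ := range_units_map_subtype (K := K) U hU
  have hunit : ∀ z : 𝒪[K], IsUnit z ↔ Valued.v (z : K) = 1 := fun z =>
    (Valuation.integer.integers (Valued.v (R := K))).isUnit_iff_valuation_eq_one
  -- the unit-moving integer `α`
  have ha : IsUnit (σO ⟨α, hα1⟩ - ⟨α, hα1⟩) := by
    rw [hunit, coe_ringHom_integer_sub hσO, Valuation.map_sub_swap]; exact hα
  have hUtop : U = (⊤ : Subgroup (𝒪[K])ˣ).map f := by rw [← MonoidHom.range_eq_map, hrange]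
  have hHM : H = Mj.map f := by
    ext u
    rw [hH, Subgroup.mem_map]
    constructor
    · rintro ⟨hu, hdep⟩
      obtain ⟨w, hw⟩ : u ∈ f.range := by rw [hrange, hU]; exact hu
      refine ⟨w, ?_, hw⟩
      rw [hMj, mem_depthSubgroup_iff hρρ hϖ hσO, Valuation.map_sub_swap]
      have hwu : ((w : 𝒪[K]) : K) = (u : K) := by rw [← hw]; rfl
      rwa [hwu]
    · rintro ⟨w, hw, rfl⟩
      rw [hMj, mem_depthSubgroup_iff hρρ hϖ hσO, Valuation.map_sub_swap] at hw
      exact ⟨(hunit (w : 𝒪[K])).1 w.isUnit, hw⟩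
  rw [hUtop, hHM, Subgroup.relIndex_map_map_of_injective _ _ hinj, Subgroup.relIndex_top_right, hMj, index_comap_eqLocus_eq σO hσOO ha hq hj, mul_comm]

end Flicker

/-! ## §2 Mars' index `[Ũ : Ṽ_{d+2m}] = q^m` on the `Θ`-fixed units, along an embedding of the third field -/

section Mars

variable {K K' : Type*} [Field K] [Valued K ℤᵐ⁰] [Field K'] [Valued K' ℤᵐ⁰] {ρ Θ : K →+* K} {σ' : K' →+* K'} {π' : K'} {d : ℕ}

/-- **MARS' INDEX ON THE THIRD FIELD, READ IN `Mˣ`**: `K′ = K♮` carries a ramified quadratic datum `(σ′, π′, d)` (`σ′` isometric involution, fixed elements of even valuation,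
`|π′| = exp(−1)`, `|π′ − σ′π′| = |π′|^d`) and `jK : K′ →+* M` is an isometric embedding ONTO the `Θ`-fixed elements with `jK ∘ σ′ = ρ ∘ jK`; then for subgroups `Ũ, Ṽ ≤ Mˣ` with
`z ∈ Ũ ↔ Θz = z ∧ |z| = 1` and `z ∈ Ṽ ↔ Θz = z ∧ |z| = 1 ∧ |z − ρz| ≤ |jK π′ ^ (d+2m)|`: **`Ṽ.relIndex Ũ = q^m`**, `q = #𝓀[K′]` (★ p857227 `relIndex_eq_pow_of_depth` on `K′`,
transported along the injective `Units.map jK`). [cite: Flicker1998UnitaryFL, Prop. 7 p. 84; §6 p. 95 REMARK] [cite: Serre1979, Ch. V §3] -/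
theorem relIndex_thetaFixed_depth_eq_pow
    (hσ' : ∀ x, σ' (σ' x) = x) (hvσ' : ∀ x, Valued.v (σ' x) = Valued.v x) (hfix' : ∀ x : K', σ' x = x → x ≠ 0 → ∃ n : ℤ, Valued.v x = exp (2 * n))
    (hπ' : Valued.v π' = exp (-1 : ℤ)) (hdd' : Valued.v (π' - σ' π') = Valued.v π' ^ d) [IsDiscreteValuationRing 𝒪[K']] [Finite 𝓀[K']] {q : ℕ} (hq : Nat.card 𝓀[K'] = q)
    (jK : K' →+* K) (hjv : ∀ x, Valued.v (jK x) = Valued.v x) (hjΘ : ∀ x, Θ (jK x) = jK x) (hjfix : ∀ z : K, Θ z = z → ∃ x, jK x = z)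
    (hjσ : ∀ x, jK (σ' x) = ρ (jK x)) (m : ℕ) (Ut Vt : Subgroup Kˣ)
    (hUt : ∀ z, z ∈ Ut ↔ Θ (z : K) = z ∧ Valued.v (z : K) = 1)
    (hVt : ∀ z, z ∈ Vt ↔ Θ (z : K) = z ∧ Valued.v (z : K) = 1 ∧ Valued.v ((z : K) - ρ z) ≤ Valued.v (jK π' ^ (d + 2 * m))) :
    Vt.relIndex Ut = q ^ m := by
  obtain ⟨U', hU'⟩ := exists_subgroup_v_eq_one (K := K')
  obtain ⟨V', hV'⟩ := exists_subgroup_depth hσ' hvσ' hπ' (d + 2 * m)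
  set f : K'ˣ →* Kˣ := Units.map (jK : K' →* K) with hf
  have hinj : Function.Injective f := by
    intro a b hab
    have := congrArg (fun u : Kˣ => (u : K)) hab
    simp only [hf, Units.coe_map, MonoidHom.coe_coe] at this
    exact Units.ext (jK.injective this)
  -- a `Θ`-fixed unit of `M` is the image of a unit of `K′`
  have hlift : ∀ z : Kˣ, Θ (z : K) = z → ∃ w : K'ˣ, f w = z := by
    intro z hz
    obtain ⟨x, hx⟩ := hjfix z hz
    have hx0 : x ≠ 0 := fun h0 => by rw [h0, map_zero] at hx; exact z.ne_zero hx.symm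
    exact ⟨Units.mk0 x hx0, Units.ext (by simp [hf, hx])⟩
  have hUt' : Ut = U'.map f := by
    ext z
    rw [hUt, Subgroup.mem_map]
    constructor
    · rintro ⟨hz, hz1⟩
      obtain ⟨w, rfl⟩ := hlift z hz
      refine ⟨w, (hU' w).2 ?_, rfl⟩
      have : Valued.v ((f w : Kˣ) : K) = 1 := hz1
      rwa [hf, Units.coe_map, MonoidHom.coe_coe, hjv] at this
    · rintro ⟨w, hw, rfl⟩
      rw [hU'] at hw
      exact ⟨by rw [hf, Units.coe_map, MonoidHom.coe_coe, hjΘ], by rw [hf, Units.coe_map, MonoidHom.coe_coe, hjv]; exact hw⟩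
  have hVt' : Vt = V'.map f := by
    ext z
    rw [hVt, Subgroup.mem_map]
    constructor
    · rintro ⟨hz, hz1, hzd⟩
      obtain ⟨w, rfl⟩ := hlift z hz
      refine ⟨w, (hV' w).2 ⟨?_, ?_⟩, rfl⟩
      · have : Valued.v ((f w : Kˣ) : K) = 1 := hz1
        rwa [hf, Units.coe_map, MonoidHom.coe_coe, hjv] at this
      · rw [hf, Units.coe_map, MonoidHom.coe_coe, ← hjσ, ← map_sub, hjv, ← map_pow, hjv, Valuation.map_sub_swap] at hzd
        exact hzd
    · rintro ⟨w, hw, rfl⟩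
      obtain ⟨hw1, hwd⟩ := (hV' w).1 hw
      refine ⟨by rw [hf, Units.coe_map, MonoidHom.coe_coe, hjΘ], by rw [hf, Units.coe_map, MonoidHom.coe_coe, hjv]; exact hw1, ?_⟩
      rw [hf, Units.coe_map, MonoidHom.coe_coe, ← hjσ, ← map_sub, hjv, ← map_pow, hjv, Valuation.map_sub_swap]
      exact hwd
  rw [hUt', hVt', Subgroup.relIndex_map_map_of_injective _ _ hinj]
  exact relIndex_eq_pow_of_depth hσ' hvσ' hfix' hπ' hdd' hq m U' V' hU' hV'


/-- **MARS ON THE THIRD FIELD, ODD LEVELS** (ED. 2): `[Ũ : Ṽ_{d+2m+1}] = q^{m+1}` along `jK` (★ `relIndex_eq_pow_of_depth_odd` on `K′`). [cite: Serre1979, Ch. IV §1 Prop. 3, Ch. V §3] -/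
theorem relIndex_thetaFixed_depth_odd_eq_pow
    (hσ' : ∀ x, σ' (σ' x) = x) (hvσ' : ∀ x, Valued.v (σ' x) = Valued.v x) (hfix' : ∀ x : K', σ' x = x → x ≠ 0 → ∃ n : ℤ, Valued.v x = exp (2 * n))
    (hπ' : Valued.v π' = exp (-1 : ℤ)) (hdd' : Valued.v (π' - σ' π') = Valued.v π' ^ d) [IsDiscreteValuationRing 𝒪[K']] [Finite 𝓀[K']] {q : ℕ} (hq : Nat.card 𝓀[K'] = q)
    (jK : K' →+* K) (hjle : ∀ x y, Valued.v (jK x) ≤ Valued.v (jK y) ↔ Valued.v x ≤ Valued.v y) (hjΘ : ∀ x, Θ (jK x) = jK x)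
    (hjfix : ∀ z : K, Θ z = z → ∃ x, jK x = z) (hjσ : ∀ x, jK (σ' x) = ρ (jK x)) (m : ℕ) (Ut Vt : Subgroup Kˣ)
    (hUt : ∀ z, z ∈ Ut ↔ Θ (z : K) = z ∧ Valued.v (z : K) = 1)
    (hVt : ∀ z, z ∈ Vt ↔ Θ (z : K) = z ∧ Valued.v (z : K) = 1 ∧ Valued.v ((z : K) - ρ z) ≤ Valued.v (jK π' ^ (d + (2 * m + 1)))) :
    Vt.relIndex Ut = q ^ (m + 1) := by
  obtain ⟨U', hU'⟩ := exists_subgroup_v_eq_one (K := K')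
  obtain ⟨V', hV'⟩ := exists_subgroup_depth hσ' hvσ' hπ' (d + (2 * m + 1))
  set f : K'ˣ →* Kˣ := Units.map (jK : K' →* K) with hf
  have hinj : Function.Injective f := by
    intro a b hab
    have := congrArg (fun u : Kˣ => (u : K)) hab
    simp only [hf, Units.coe_map, MonoidHom.coe_coe] at this
    exact Units.ext (jK.injective this)
  have hj1 : ∀ x : K', Valued.v (jK x) = 1 ↔ Valued.v x = 1 := by
    intro x
    have h1 := hjle x 1
    have h2 := hjle 1 x
    rw [map_one, map_one, map_one] at h1 h2
    exact ⟨fun h => le_antisymm (h1.1 h.le) (h2.1 h.ge), fun h => le_antisymm (h1.2 h.le) (h2.2 h.ge)⟩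
  have hlift : ∀ z : Kˣ, Θ (z : K) = z → ∃ w : K'ˣ, f w = z := by
    intro z hz
    obtain ⟨x, hx⟩ := hjfix z hz
    have hx0 : x ≠ 0 := fun h0 => by rw [h0, map_zero] at hx; exact z.ne_zero hx.symm
    exact ⟨Units.mk0 x hx0, Units.ext (by simp [hf, hx])⟩
  have hUt' : Ut = U'.map f := by
    ext z
    rw [hUt, Subgroup.mem_map]
    constructor
    · rintro ⟨hz, hz1⟩
      obtain ⟨w, rfl⟩ := hlift z hz
      refine ⟨w, (hU' w).2 ?_, rfl⟩
      have : Valued.v ((f w : Kˣ) : K) = 1 := hz1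
      rwa [hf, Units.coe_map, MonoidHom.coe_coe, hj1] at this
    · rintro ⟨w, hw, rfl⟩
      rw [hU'] at hw
      exact ⟨by rw [hf, Units.coe_map, MonoidHom.coe_coe, hjΘ], by rw [hf, Units.coe_map, MonoidHom.coe_coe, hj1]; exact hw⟩
  have hVt' : Vt = V'.map f := by
    ext z
    rw [hVt, Subgroup.mem_map]
    constructor
    · rintro ⟨hz, hz1, hzd⟩
      obtain ⟨w, rfl⟩ := hlift z hz
      refine ⟨w, (hV' w).2 ⟨?_, ?_⟩, rfl⟩
      · have : Valued.v ((f w : Kˣ) : K) = 1 := hz1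
        rwa [hf, Units.coe_map, MonoidHom.coe_coe, hj1] at this
      · rw [hf, Units.coe_map, MonoidHom.coe_coe, ← hjσ, ← map_sub, ← map_pow, hjle, Valuation.map_sub_swap] at hzd
        exact hzd
    · rintro ⟨w, hw, rfl⟩
      obtain ⟨hw1, hwd⟩ := (hV' w).1 hw
      refine ⟨by rw [hf, Units.coe_map, MonoidHom.coe_coe, hjΘ], by rw [hf, Units.coe_map, MonoidHom.coe_coe, hj1]; exact hw1, ?_⟩
      rw [hf, Units.coe_map, MonoidHom.coe_coe, ← hjσ, ← map_sub, ← map_pow, hjle, Valuation.map_sub_swap]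
      exact hwd
  rw [hUt', hVt', Subgroup.relIndex_map_map_of_injective _ _ hinj]
  exact relIndex_eq_pow_of_depth_odd hσ' hvσ' hfix' hπ' hdd' hq m U' V' hU' hV'

/-- **MARS ON THE THIRD FIELD, LOW LEVELS** (ED. 2): `[Ũ : Ṽ_k] = 1` for `k ≤ d` along `jK` (★ `relIndex_eq_one_of_depth_le` on `K′`). [cite: Serre1979, Ch. IV §1 Prop. 4] -/
theorem relIndex_thetaFixed_depth_eq_one_of_le
    (hσ' : ∀ x, σ' (σ' x) = x) (hvσ' : ∀ x, Valued.v (σ' x) = Valued.v x) (hfix' : ∀ x : K', σ' x = x → x ≠ 0 → ∃ n : ℤ, Valued.v x = exp (2 * n))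
    (hπ' : Valued.v π' = exp (-1 : ℤ)) (hdd' : Valued.v (π' - σ' π') = Valued.v π' ^ d) [IsDiscreteValuationRing 𝒪[K']]
    (jK : K' →+* K) (hjle : ∀ x y, Valued.v (jK x) ≤ Valued.v (jK y) ↔ Valued.v x ≤ Valued.v y) (hjΘ : ∀ x, Θ (jK x) = jK x)
    (hjfix : ∀ z : K, Θ z = z → ∃ x, jK x = z) (hjσ : ∀ x, jK (σ' x) = ρ (jK x)) {k : ℕ} (hk : k ≤ d) (Ut Vt : Subgroup Kˣ)
    (hUt : ∀ z, z ∈ Ut ↔ Θ (z : K) = z ∧ Valued.v (z : K) = 1)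
    (hVt : ∀ z, z ∈ Vt ↔ Θ (z : K) = z ∧ Valued.v (z : K) = 1 ∧ Valued.v ((z : K) - ρ z) ≤ Valued.v (jK π' ^ k)) :
    Vt.relIndex Ut = 1 := by
  obtain ⟨U', hU'⟩ := exists_subgroup_v_eq_one (K := K')
  obtain ⟨V', hV'⟩ := exists_subgroup_depth hσ' hvσ' hπ' k
  set f : K'ˣ →* Kˣ := Units.map (jK : K' →* K) with hf
  have hinj : Function.Injective f := by
    intro a b hab
    have := congrArg (fun u : Kˣ => (u : K)) hab
    simp only [hf, Units.coe_map, MonoidHom.coe_coe] at this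
    exact Units.ext (jK.injective this)
  have hj1 : ∀ x : K', Valued.v (jK x) = 1 ↔ Valued.v x = 1 := by
    intro x
    have h1 := hjle x 1
    have h2 := hjle 1 x
    rw [map_one, map_one, map_one] at h1 h2
    exact ⟨fun h => le_antisymm (h1.1 h.le) (h2.1 h.ge), fun h => le_antisymm (h1.2 h.le) (h2.2 h.ge)⟩
  have hlift : ∀ z : Kˣ, Θ (z : K) = z → ∃ w : K'ˣ, f w = z := by
    intro z hz
    obtain ⟨x, hx⟩ := hjfix z hz
    have hx0 : x ≠ 0 := fun h0 => by rw [h0, map_zero] at hx; exact z.ne_zero hx.symm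
    exact ⟨Units.mk0 x hx0, Units.ext (by simp [hf, hx])⟩
  have hUt' : Ut = U'.map f := by
    ext z
    rw [hUt, Subgroup.mem_map]
    constructor
    · rintro ⟨hz, hz1⟩
      obtain ⟨w, rfl⟩ := hlift z hz
      refine ⟨w, (hU' w).2 ?_, rfl⟩
      have : Valued.v ((f w : Kˣ) : K) = 1 := hz1
      rwa [hf, Units.coe_map, MonoidHom.coe_coe, hj1] at this
    · rintro ⟨w, hw, rfl⟩
      rw [hU'] at hw
      exact ⟨by rw [hf, Units.coe_map, MonoidHom.coe_coe, hjΘ], by rw [hf, Units.coe_map, MonoidHom.coe_coe, hj1]; exact hw⟩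
  have hVt' : Vt = V'.map f := by
    ext z
    rw [hVt, Subgroup.mem_map]
    constructor
    · rintro ⟨hz, hz1, hzd⟩
      obtain ⟨w, rfl⟩ := hlift z hz
      refine ⟨w, (hV' w).2 ⟨?_, ?_⟩, rfl⟩
      · have : Valued.v ((f w : Kˣ) : K) = 1 := hz1
        rwa [hf, Units.coe_map, MonoidHom.coe_coe, hj1] at this
      · rw [hf, Units.coe_map, MonoidHom.coe_coe, ← hjσ, ← map_sub, ← map_pow, hjle, Valuation.map_sub_swap] at hzd
        exact hzd
    · rintro ⟨w, hw, rfl⟩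
      obtain ⟨hw1, hwd⟩ := (hV' w).1 hw
      refine ⟨by rw [hf, Units.coe_map, MonoidHom.coe_coe, hjΘ], by rw [hf, Units.coe_map, MonoidHom.coe_coe, hj1]; exact hw1, ?_⟩
      rw [hf, Units.coe_map, MonoidHom.coe_coe, ← hjσ, ← map_sub, ← map_pow, hjle, Valuation.map_sub_swap]
      exact hwd
  rw [hUt', hVt', Subgroup.relIndex_map_map_of_injective _ _ hinj]
  exact relIndex_eq_one_of_depth_le hσ' hvσ' hfix' hπ' hdd' hk U' V' hU' hV'

end Mars

/-! ## §3 The norm pull-back `[U_M : B_r] = [Ũ : Ṽ_r]` and the quotient `[B_r : 𝒪_jˣ]` -/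

section Norm

variable {K : Type*} [Field K] [Valued K ℤᵐ⁰] {ρ Θ : K →+* K}

/-- **THE NORM PULL-BACK**: if `ω ↦ ωΘω` maps the units of `M` ONTO the `Θ`-fixed units (binder `hnorm` — Serre V §2 for the unramified `M ∕ K♮`), then for
`B = {ω : |ω| = 1, |ωΘω − ρ(ωΘω)| ≤ r}`, `Ṽ = {Θz = z, |z| = 1, |z − ρz| ≤ r}`, `Ũ = {Θz = z, |z| = 1}`, `U = {|ω| = 1}`: **`B.relIndex U = Ṽ.relIndex Ũ`**
(`B = U ⊓ N⁻¹Ṽ` for the norm hom `N = MonoidHom.id · Units.map Θ`, `N(U) = Ũ`, `Subgroup.relIndex_comap`). [cite: Serre1979, Ch. V §2 Prop. 3, §3] -/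
theorem relIndex_normDepth_eq (hΘΘ : ∀ x, Θ (Θ x) = x) (hvΘ : ∀ x, Valued.v (Θ x) = Valued.v x)
    (hnorm : ∀ z : Kˣ, Θ (z : K) = z → Valued.v (z : K) = 1 → ∃ ω : Kˣ, Valued.v (ω : K) = 1 ∧ (ω : K) * Θ ω = z)
    (r : ℤᵐ⁰) (U Ut Vt B : Subgroup Kˣ) (hU : ∀ u, u ∈ U ↔ Valued.v (u : K) = 1)
    (hUt : ∀ z, z ∈ Ut ↔ Θ (z : K) = z ∧ Valued.v (z : K) = 1)
    (hVt : ∀ z, z ∈ Vt ↔ Θ (z : K) = z ∧ Valued.v (z : K) = 1 ∧ Valued.v ((z : K) - ρ z) ≤ r)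
    (hB : ∀ ω, ω ∈ B ↔ Valued.v (ω : K) = 1 ∧ Valued.v ((ω : K) * Θ ω - ρ ((ω : K) * Θ ω)) ≤ r) :
    B.relIndex U = Vt.relIndex Ut := by
  set N : Kˣ →* Kˣ := MonoidHom.id Kˣ * Units.map (Θ : K →* K) with hN
  have hNval : ∀ ω : Kˣ, ((N ω : Kˣ) : K) = (ω : K) * Θ ω := fun ω => by
    rw [hN, MonoidHom.mul_apply, Units.val_mul, Units.coe_map, MonoidHom.id_apply, MonoidHom.coe_coe]
  have hNΘ : ∀ ω : Kˣ, Θ (((N ω : Kˣ) : K)) = ((N ω : Kˣ) : K) := fun ω => by rw [hNval, map_mul, hΘΘ, mul_comm]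
  have hN1 : ∀ {ω : Kˣ}, Valued.v (ω : K) = 1 → Valued.v (((N ω : Kˣ) : K)) = 1 := fun hω => by rw [hNval, map_mul, hvΘ, hω, mul_one]
  -- `B = U ⊓ N⁻¹ Ṽ`
  have hBeq : B = (Vt.comap N) ⊓ U := by
    ext ω
    rw [hB, Subgroup.mem_inf, Subgroup.mem_comap, hVt, hU]
    constructor
    · rintro ⟨h1, h2⟩
      exact ⟨⟨hNΘ ω, hN1 h1, by rw [hNval]; exact h2⟩, h1⟩
    · rintro ⟨⟨-, -, h2⟩, h1⟩
      rw [hNval] at h2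
      exact ⟨h1, h2⟩
  -- `N(U) = Ũ`
  have hNU : U.map N = Ut := by
    ext z
    rw [Subgroup.mem_map, hUt]
    constructor
    · rintro ⟨ω, hω, rfl⟩
      rw [hU] at hω
      exact ⟨hNΘ ω, hN1 hω⟩
    · rintro ⟨hz, hz1⟩
      obtain ⟨ω, hω1, hω⟩ := hnorm z hz hz1
      exact ⟨ω, (hU ω).2 hω1, Units.ext (by rw [hNval]; exact hω)⟩
  rw [hBeq, Subgroup.inf_relIndex_right, Subgroup.relIndex_comap, hNU]

end Norm

end Literature.NumberTheory.LocalFields.QuadraticOrder
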